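import Literature.NumberTheory.PAdicHodge.BdRBaseChange
import Literature.NumberTheory.PAdicHodge.CompletedAlgClosureBaseChange
import Literature.NumberTheory.PAdicHodge.LocalFieldEmbeddingNorm
import Literature.NumberTheory.PAdicHodge.AlgClosureToBdR
import Literature.NumberTheory.GaloisRepresentations.PadicAlgebraIntegral
import Literature.NumberTheory.GaloisRepresentations.AbsGaloisGroupProofs
import HarnessLib

/-!
# `B_dR(K) ≃ B_dR(L)` along `K → L` is filtered, `θ`-compatible and extends `K̄ ≅ L̄`

Topic `NumberTheory/PAdicHodge`; theorems only (no definition, no named fact).  The accepted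
`BdRBaseChange.exists_fracBdR_ringEquiv` produces, for a continuous embedding `K → L` of `ℓ`-adic
local fields, a ring isomorphism `Φ : B_dR(K) ≃ B_dR(L)` (`Φ = Frac B_dR⁺(g)` for the equivariant
`g : 𝒪_{ℂ_K} ≃ 𝒪_{ℂ_L}` of `CompletedAlgClosureBaseChange`) which is equivariant for
`res = absGaloisRestrict K L` and the identity on `ℚ_ℓ`, and records as NOT done "the compatibility
of `Φ` with the filtrations `Fil^i = ξ^i B_dR⁺` or with `θ`".  This file supplies exactly that
(`exists_fracBdR_ringEquiv_filtered`): a `Φ` which in addition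

* is **compatible with `θ`**: `θ_L (B_dR⁺(g) b) = e (θ_K b)` for the isomorphism `e : ℂ_K ≃ ℂ_L`
  extending the chosen `ι = absClosureEmbedding K L : K̄ → L̄` (naturality of `θ[1/ℓ]`,
  `fontaineThetaInvertP_map`/`fontaineTheta_map_tiltMap`, and `ker θ = (ξ) =` non-units);
* **extends `ι`**: `Φ (ι_K x) = ι_L (ι x)` for Fontaine's sections `ι_F : F̄ → B_dR⁺(F)`
  (`algClosureToBdR`), in particular `Φ|_K = (K → L ⊆ B_dR(L))` for the embeddings `embBdRHom`
  (Hensel uniqueness of the lifts: `root_unique`, `eq_liftElt`);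
* is **strictly compatible with the filtrations**: `b ∈ Fil^i B_dR(K) ↔ Φ b ∈ Fil^i B_dR(L)` for all
  `i ∈ ℤ` (a ring isomorphism of the discrete valuation rings `B_dR⁺` maps the uniformiser `ξ_K`
  to `ξ_L ·` unit).

This is the remaining functoriality input of Brinon–Conrad, *CMI notes*, Prop. 6.3.8 ("the natural
map `K' ⊗_K D_{dR,K}(V) → D_{dR,K'}(V)` is an isomorphism in `Fil_{K'}`") for a finite extension,
used to compare labelled Hodge–Tate weights over `K` and over `L`
(file `LabelledHodgeTateWeightsBaseChangeProofs`).

## References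

* [BrinonConrad2009] O. Brinon, B. Conrad, *CMI Summer School notes on p-adic Hodge theory*
  (2009), p. 80 and Prop. 6.3.8.
* [FontaineAsterisque223III] J.-M. Fontaine, *Le corps des périodes p-adiques*, Astérisque 223
  (1994), Exp. II §1.2, §1.5.
-/

noncomputable section

open Field ValuativeRel Ideal WittVector Polynomial
open Literature.AlgebraicGeometry.Resolution

namespace Literature.NumberTheory.PAdicHodge

open Literature.NumberTheory.GaloisRepresentations
open Literature.NumberTheory.GaloisRepresentations.IsNonarchimedeanLocalField

section LocalField

variable {K L : Type} [Field K] [ValuativeRel K] [TopologicalSpace K] [IsNonarchimedeanLocalField K]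
  [CharZero K] [Field L] [ValuativeRel L] [TopologicalSpace L] [IsNonarchimedeanLocalField L]
  [CharZero L] [Algebra K L] {ℓ : ℕ} [Fact ℓ.Prime]
  [Fact (¬ IsUnit ((ℓ : ℕ) : integerC K))] [IsAdicComplete (Ideal.span {((ℓ : ℕ) : integerC K)}) (integerC K)]
  [Fact (¬ IsUnit ((ℓ : ℕ) : integerC L))] [IsAdicComplete (Ideal.span {((ℓ : ℕ) : integerC L)}) (integerC L)]

/-! ### `θ`-compatibility of `B_dR⁺(g)` -/

omit [Algebra K L] in
/-- **Naturality of `θ_ℂ : 𝔸_inf[1/ℓ] → ℂ`** along `g : 𝒪_{ℂ_K} → 𝒪_{ℂ_L}` restricting a ring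
homomorphism `e : ℂ_K → ℂ_L`: `θ_ℂ (𝕎(g♭)[1/ℓ] z) = e (θ_ℂ z)` (from the naturality of `θ`,
`fontaineTheta_map_tiltMap`). [cite: FontaineAsterisque223III, Exp. II §1.2] -/
theorem thetaLoc_map (g : integerC K →+* integerC L)
    (e : CompletedAlgClosure K →+* CompletedAlgClosure L)
    (hge : ∀ x : integerC K, ((g x : integerC L) : CompletedAlgClosure L) = e x)
    (z : Localization.Away ((ℓ : ℕ) : Ainf (p := ℓ) K)) :
    thetaLoc (IsLocalization.map (Localization.Away ((ℓ : ℕ) : Ainf (p := ℓ) L))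
        (WittVector.map (p := ℓ) (tiltMap ℓ g)) (powers_natCast_le_comap ℓ _) z) =
      e (thetaLoc z) := by
  have h : (thetaLoc (F := L) (p := ℓ)).comp
        (IsLocalization.map (S := Localization.Away ((ℓ : ℕ) : Ainf (p := ℓ) K))
          (Localization.Away ((ℓ : ℕ) : Ainf (p := ℓ) L))
          (WittVector.map (p := ℓ) (tiltMap ℓ g)) (powers_natCast_le_comap ℓ _)) =
      e.comp thetaLoc := by
    refine IsLocalization.ringHom_ext (Submonoid.powers ((ℓ : ℕ) : Ainf (p := ℓ) K))
      (RingHom.ext fun y => ?_)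
    simp only [RingHom.coe_comp, Function.comp_apply]
    rw [IsLocalization.map_eq, thetaLoc_algebraMap, thetaLoc_algebraMap, fontaineTheta_map_tiltMap, hge]
  exact RingHom.congr_fun h z

omit [CharZero K] [CharZero L] [Algebra K L] in
/-- A ring isomorphism `Φp : B_dR⁺(K) ≃ B_dR⁺(L)` detects units. [folklore] -/
theorem isUnit_iff_of_ringEquiv (Φp : BDeRhamPlus (integerC K) ℓ ≃+* BDeRhamPlus (integerC L) ℓ)
    (x : BDeRhamPlus (integerC K) ℓ) : IsUnit (Φp x) ↔ IsUnit x :=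
  ⟨fun h => by simpa using h.map Φp.symm, fun h => h.map Φp⟩

omit [Algebra K L] in
/-- **`θ`-compatibility of `B_dR⁺(g)`**: if `Φp = B_dR⁺(g)` is a ring isomorphism and `g` is the
restriction of a ring homomorphism `e : ℂ_K → ℂ_L`, then `θ_L (Φp b) = e (θ_K b)` for all
`b ∈ B_dR⁺(K)` (approximate `b` by `z ∈ 𝔸_inf[1/ℓ]` modulo `ker θ = (ξ)`, which consists of
non-units and is therefore mapped into `ker θ`). [cite: BrinonConrad2009, Prop. 6.3.8] -/
theorem thetaBdR_ringEquiv_eq (hK : valuation K (ℓ : K) < 1) (hL : valuation L (ℓ : L) < 1)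
    (g : integerC K →+* integerC L) (e : CompletedAlgClosure K →+* CompletedAlgClosure L)
    (hge : ∀ x : integerC K, ((g x : integerC L) : CompletedAlgClosure L) = e x)
    (Φp : BDeRhamPlus (integerC K) ℓ ≃+* BDeRhamPlus (integerC L) ℓ)
    (hΦp : ∀ x, Φp x = adicCompletionMap _ _ _ (map_ker_fontaineThetaInvertP_le ℓ g) x)
    (b : BDeRhamPlus (integerC K) ℓ) : thetaBdR (Φp b) = e (thetaBdR b) := by
  have hFK : Function.Surjective (fontaineTheta (integerC K) ℓ) := surjective_fontaineTheta_integerC hK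
  have hFL : Function.Surjective (fontaineTheta (integerC L) ℓ) := surjective_fontaineTheta_integerC hL
  obtain ⟨z, hz⟩ := Ideal.Quotient.mk_surjective
    (AdicCompletion.evalOneₐ (RingHom.ker (fontaineThetaInvertP (integerC K) ℓ)) b)
  have hmem := sub_algebraMap_mem_span hz.symm
  -- `θ_K b = θ_ℂ z`
  have h1 : thetaBdR b = thetaLoc z := by
    have : b = (b - algebraMap _ _ z) + algebraMap (Localization.Away ((ℓ : ℕ) : Ainf (p := ℓ) K))
        (BDeRhamPlus (integerC K) ℓ) z := by ring
    rw [this, map_add, thetaBdR_eq_zero_of_mem_span hmem, zero_add, thetaBdR_algebraMap]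
  -- `Φp (b - z)` is a non-unit, hence killed by `θ_L`
  have h2 : thetaBdR (Φp (b - algebraMap _ _ z)) = 0 := by
    by_contra hne
    have hu : IsUnit (b - algebraMap _ _ z) :=
      (isUnit_iff_of_ringEquiv Φp _).1 ((isUnit_iff_thetaBdR_ne_zero hFL _).2 hne)
    exact ((isUnit_iff_thetaBdR_ne_zero hFK _).1 hu) ((mem_ker_thetaBdR_iff _).2 hmem)
  -- `Φp z = 𝕎(g♭)[1/ℓ] z`
  have h3 : thetaBdR (Φp (algebraMap (Localization.Away ((ℓ : ℕ) : Ainf (p := ℓ) K))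
      (BDeRhamPlus (integerC K) ℓ) z)) = e (thetaLoc z) := by
    rw [hΦp, algebraMap_bDeRhamPlus_apply, bdRPlusMap_of, ← algebraMap_bDeRhamPlus_apply,
      thetaBdR_algebraMap, thetaLoc_map g e hge]
  have : b = (b - algebraMap _ _ z) + algebraMap (Localization.Away ((ℓ : ℕ) : Ainf (p := ℓ) K))
      (BDeRhamPlus (integerC K) ℓ) z := by ring
  rw [h1, this, map_add, map_add, h2, zero_add, h3]

/-! ### The uniformiser: `Φp ξ_K = ξ_L · unit`, and the filtration -/

omit [Algebra K L] in
/-- **A ring isomorphism `B_dR⁺(K) ≃ B_dR⁺(L)` maps `ξ_K` to `ξ_L ·` unit** (both are discrete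
valuation rings with uniformisers `ξ`: every nonzero element is `ξⁿ ·` unit). [folklore] -/
theorem exists_unit_ringEquiv_xiBdR_eq (hK : valuation K (ℓ : K) < 1) (hL : valuation L (ℓ : L) < 1)
    (Φp : BDeRhamPlus (integerC K) ℓ ≃+* BDeRhamPlus (integerC L) ℓ) :
    ∃ w : (BDeRhamPlus (integerC L) ℓ)ˣ, Φp xiBdR = xiBdR * (w : BDeRhamPlus (integerC L) ℓ) := by
  have hFK : Function.Surjective (fontaineTheta (integerC K) ℓ) := surjective_fontaineTheta_integerC hK
  have hFL : Function.Surjective (fontaineTheta (integerC L) ℓ) := surjective_fontaineTheta_integerC hL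
  -- `ξ` is a nonzero non-unit on both sides
  have hnuK : ¬ IsUnit (xiBdR : BDeRhamPlus (integerC K) ℓ) := fun h =>
    ((isUnit_iff_thetaBdR_ne_zero hFK _).1 h) thetaBdR_xiBdR
  have hnuL : ¬ IsUnit (xiBdR : BDeRhamPlus (integerC L) ℓ) := fun h =>
    ((isUnit_iff_thetaBdR_ne_zero hFL _).1 h) thetaBdR_xiBdR
  have h0K : (xiBdR : BDeRhamPlus (integerC K) ℓ) ≠ 0 := fun h =>
    algebraMap_xiBdR_ne_zero (F := K) (p := ℓ) hFK (by rw [h, map_zero])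
  have h0L : (xiBdR : BDeRhamPlus (integerC L) ℓ) ≠ 0 := fun h =>
    algebraMap_xiBdR_ne_zero (F := L) (p := ℓ) hFL (by rw [h, map_zero])
  -- `Φp ξ_K = ξ_L ^ n * u`, `Φp⁻¹ ξ_L = ξ_K ^ m * u'`
  obtain ⟨n, u, hu, hn⟩ := exists_eq_xi_pow_mul_bDeRhamPlus hFL
    (show Φp xiBdR ≠ 0 from fun h => h0K (by simpa using congrArg Φp.symm h))
  obtain ⟨m, u', hu', hm⟩ := exists_eq_xi_pow_mul_bDeRhamPlus hFK
    (show Φp.symm xiBdR ≠ 0 from fun h => h0L (by simpa using congrArg Φp h))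
  -- `ξ_L = ξ_L ^ (n * m) * (u ^ m * Φp u')`
  have key : (xiBdR : BDeRhamPlus (integerC L) ℓ) = xiBdR ^ (n * m) * (u ^ m * Φp u') := by
    conv_lhs => rw [← Φp.apply_symm_apply xiBdR, hm, map_mul, map_pow, hn]
    rw [mul_pow, pow_mul]; ring
  have hnm : n * m = 1 := by
    rcases Nat.lt_or_ge (n * m) 1 with h | h
    · -- `n * m = 0`: then `ξ_L` would be a unit
      have h0 : n * m = 0 := by omega
      rw [h0, pow_zero, one_mul] at key
      exact absurd (key ▸ (hu.pow m).mul (hu'.map Φp)) hnuL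
    · rcases Nat.eq_or_lt_of_le h with h1 | h1
      · exact h1.symm
      · -- `n * m ≥ 2`: cancel `ξ_L` and get `ξ_L ∣ 1`
        exfalso
        obtain ⟨k, hk⟩ := Nat.exists_eq_add_of_le (show 2 ≤ n * m from h1)
        have key' : (xiBdR : BDeRhamPlus (integerC L) ℓ) * 1 =
            xiBdR * (xiBdR ^ (k + 1) * (u ^ m * Φp u')) := by
          rw [mul_one, ← mul_assoc, ← pow_succ', show k + 1 + 1 = n * m by omega]; exact key
        have hc := eq_zero_of_xiBdR_mul_eq_zero (F := L) (p := ℓ)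
          (x := 1 - xiBdR ^ (k + 1) * (u ^ m * Φp u')) (by rw [mul_sub, sub_eq_zero]; exact key')
        refine hnuL (isUnit_of_dvd_one ⟨xiBdR ^ k * (u ^ m * Φp u'), ?_⟩)
        rw [sub_eq_zero] at hc
        rw [hc]; ring
  have hn1 : n = 1 := Nat.eq_one_of_mul_eq_one_right hnm
  rw [hn1, pow_one] at hn
  exact ⟨hu.unit, by rw [IsUnit.unit_spec]; exact hn⟩

variable [IsDomain (BDeRhamPlus (integerC K) ℓ)] [IsDomain (BDeRhamPlus (integerC L) ℓ)]

omit [Algebra K L] in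
/-- **`Φ = Frac Φp` maps `Fil^i B_dR(K)` into `Fil^i B_dR(L)`** (`Φ (ξ_K^i b) = ξ_L^i · wⁱ · Φp b`).
[cite: FontaineAsterisque223III, Exp. II §1.5] -/
theorem ringEquiv_mem_fil_of_mem_fil (hK : valuation K (ℓ : K) < 1) (hL : valuation L (ℓ : L) < 1)
    (hFK : Function.Surjective (fontaineTheta (integerC K) ℓ))
    (hFL : Function.Surjective (fontaineTheta (integerC L) ℓ))
    (Φp : BDeRhamPlus (integerC K) ℓ ≃+* BDeRhamPlus (integerC L) ℓ)
    (Φ : FracBdR K ℓ ≃+* FracBdR L ℓ)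
    (hΦ : ∀ x, Φ (algebraMap (BDeRhamPlus (integerC K) ℓ) (FracBdR K ℓ) x) =
      algebraMap (BDeRhamPlus (integerC L) ℓ) (FracBdR L ℓ) (Φp x))
    (i : ℤ) {b : FracBdR K ℓ} (hb : letI := fracAlgebra (p := ℓ) hK hFK; b ∈ fil hK hFK i) :
    letI := fracAlgebra (p := ℓ) hL hFL; Φ b ∈ fil hL hFL i := by
  obtain ⟨w, hw⟩ := exists_unit_ringEquiv_xiBdR_eq hK hL Φp
  rw [mem_fil_iff] at hb ⊢
  obtain ⟨c, rfl⟩ := hb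
  refine ⟨((w ^ i : (BDeRhamPlus (integerC L) ℓ)ˣ) : BDeRhamPlus (integerC L) ℓ) * Φp c, ?_⟩
  rw [map_mul, map_zpow₀, hΦ, hΦ, hw, map_mul, mul_zpow, map_mul, algebraMap_units_zpow]
  ring

omit [Algebra K L] in
/-- **`Φ` is strictly compatible with the filtrations**: `b ∈ Fil^i B_dR(K) ↔ Φ b ∈ Fil^i B_dR(L)`
(apply `ringEquiv_mem_fil_of_mem_fil` to `Φ` and to `Φ⁻¹ = Frac Φp⁻¹`).
[cite: BrinonConrad2009, Prop. 6.3.8] [cite: FontaineAsterisque223III, Exp. II §1.5] -/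
theorem mem_fil_iff_ringEquiv_mem_fil (hK : valuation K (ℓ : K) < 1) (hL : valuation L (ℓ : L) < 1)
    (hFK : Function.Surjective (fontaineTheta (integerC K) ℓ))
    (hFL : Function.Surjective (fontaineTheta (integerC L) ℓ))
    (Φp : BDeRhamPlus (integerC K) ℓ ≃+* BDeRhamPlus (integerC L) ℓ)
    (Φ : FracBdR K ℓ ≃+* FracBdR L ℓ)
    (hΦ : ∀ x, Φ (algebraMap (BDeRhamPlus (integerC K) ℓ) (FracBdR K ℓ) x) =
      algebraMap (BDeRhamPlus (integerC L) ℓ) (FracBdR L ℓ) (Φp x))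
    (i : ℤ) (b : FracBdR K ℓ) :
    (letI := fracAlgebra (p := ℓ) hK hFK; b ∈ fil hK hFK i) ↔
      letI := fracAlgebra (p := ℓ) hL hFL; Φ b ∈ fil hL hFL i := by
  refine ⟨ringEquiv_mem_fil_of_mem_fil hK hL hFK hFL Φp Φ hΦ i, fun h => ?_⟩
  have hΦ' : ∀ y, Φ.symm (algebraMap (BDeRhamPlus (integerC L) ℓ) (FracBdR L ℓ) y) =
      algebraMap (BDeRhamPlus (integerC K) ℓ) (FracBdR K ℓ) (Φp.symm y) := fun y => by
    apply Φ.injective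
    rw [Φ.apply_symm_apply, hΦ, Φp.apply_symm_apply]
  simpa using ringEquiv_mem_fil_of_mem_fil hL hK hFL hFK Φp.symm Φ.symm hΦ' i h

/-! ### Compatibility with the embeddings `K ⊆ B_dR⁺(K)`, `K̄ ⊆ B_dR⁺(K)` -/

omit [IsDomain (BDeRhamPlus (integerC K) ℓ)] [IsDomain (BDeRhamPlus (integerC L) ℓ)] in
/-- **`Φp` extends `K → L` on the base fields**: `Φp (x̃) = (x|_L)~` for the Hensel embeddings
`embBdRHom : F → B_dR⁺(F)` — both `Φp ∘ embBdRHom_K` and `embBdRHom_L ∘ (K → L)` are ring maps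
`K → B_dR⁺(L)` agreeing on `ℚ_ℓ` (rigidity of `ℚ_ℓ → L`, `LocalField.ringHom_padic_ext`, and
`Φp|_{ℚ_ℓ} = id`) and sending a primitive element `α` of `K/ℚ_ℓ` to roots of its minimal polynomial
with the same image `α ∈ ℂ_L` under `θ` (`θ`-compatibility of `Φp`), hence equal (`root_unique`).
[cite: FontaineAsterisque223III, Exp. II §1.5] [cite: BrinonConrad2009, Prop. 6.3.8] -/
theorem ringEquiv_embBdRHom (hK : valuation K (ℓ : K) < 1) (hL : valuation L (ℓ : L) < 1)
    (hFK : Function.Surjective (fontaineTheta (integerC K) ℓ))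
    (hFL : Function.Surjective (fontaineTheta (integerC L) ℓ))
    (g : integerC K →+* integerC L) (e : CompletedAlgClosure K →+* CompletedAlgClosure L)
    (hge : ∀ x : integerC K, ((g x : integerC L) : CompletedAlgClosure L) = e x)
    (heK : ∀ x : K, e (algebraMap K (CompletedAlgClosure K) x) =
      algebraMap L (CompletedAlgClosure L) (algebraMap K L x))
    (Φp : BDeRhamPlus (integerC K) ℓ ≃+* BDeRhamPlus (integerC L) ℓ)
    (hΦp : ∀ x, Φp x = adicCompletionMap _ _ _ (map_ker_fontaineThetaInvertP_le ℓ g) x)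
    (x : K) : Φp (embBdRHom hK hFK x) = embBdRHom hL hFL (algebraMap K L x) := by
  -- the canonical maps `ℚ_ℓ → K → L` and `ℚ_ℓ → L` agree
  have hKL : ∀ c : PadicBase K ℓ hK, algebraMap K L (algebraMap (PadicBase K ℓ hK) K c) =
      algebraMap (PadicBase L ℓ hL) L ((PadicBase.toPadic hL).symm (PadicBase.toPadic hK c)) := by
    intro c
    change ((algebraMap K L).comp (LocalField.padicRingHom K ℓ hK)) (PadicBase.toPadic hK c) =
      LocalField.padicRingHom L ℓ hL _
    rw [LocalField.ringHom_padic_ext ((algebraMap K L).comp (LocalField.padicRingHom K ℓ hK))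
      (LocalField.padicRingHom L ℓ hL)]
    rfl
  -- agreement on `ℚ_ℓ`
  have h0 : ∀ c : PadicBase K ℓ hK, Φp (embBdRHom hK hFK (algebraMap (PadicBase K ℓ hK) K c)) =
      embBdRHom hL hFL (algebraMap K L (algebraMap (PadicBase K ℓ hK) K c)) := by
    intro c
    rw [embBdRHom_algebraMap, hΦp, bdRPlusMap_qpToBdR, hKL, embBdRHom_algebraMap]
    rfl
  -- the two ring maps `K → B_dR⁺(L)`
  set ψ : K →+* BDeRhamPlus (integerC L) ℓ := (embBdRHom hL hFL).comp (algebraMap K L) with hψ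
  letI := baseAlgebraBdR (F := K) (p := ℓ) hK
  have hbase : Φp.toRingHom.comp (algebraMap (PadicBase K ℓ hK) (BDeRhamPlus (integerC K) ℓ)) =
      ψ.comp (algebraMap (PadicBase K ℓ hK) K) := by
    refine RingHom.ext fun c => ?_
    simp only [RingHom.coe_comp, Function.comp_apply, hψ]
    rw [← h0 c, embBdRHom_algebraMap, algebraMap_baseAlgebraBdR]
    rfl
  -- the minimal polynomial of the primitive element, pushed to `B_dR⁺(L)`
  set f : (BDeRhamPlus (integerC L) ℓ)[X] := (minpolyBdR hK).map Φp.toRingHom with hf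
  have hf' : f = (minpoly (PadicBase K ℓ hK) (basePowerBasis hK).gen).map
      (ψ.comp (algebraMap (PadicBase K ℓ hK) K)) := by
    rw [hf, minpolyBdR, Polynomial.map_map, hbase]
  -- its two roots
  have ha : f.eval (ψ (basePowerBasis hK).gen) = 0 := by
    rw [hf', eval_map, ← hom_eval₂, ← aeval_def, minpoly.aeval, map_zero]
  have ha' : f.eval (Φp (rootBdR hK hFK)) = 0 := by
    rw [hf, eval_map, show (Φp (rootBdR hK hFK)) = Φp.toRingHom (rootBdR hK hFK) from rfl,
      eval₂_hom, eval_rootBdR, map_zero]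
  -- with the same image under `θ`
  have hθψ : ∀ y : K, thetaBdR (ψ y) = algebraMap L (CompletedAlgClosure L) (algebraMap K L y) :=
    fun y => thetaBdR_embBdRHom hL hFL _
  have hθ : thetaBdR (Φp (rootBdR hK hFK)) = thetaBdR (ψ (basePowerBasis hK).gen) := by
    rw [thetaBdR_ringEquiv_eq hK hL g e hge Φp hΦp, thetaBdR_rootBdR, heK, hθψ]
  -- a simple root
  have hder : thetaBdR (f.derivative.eval (ψ (basePowerBasis hK).gen)) ≠ 0 := by
    rw [hf', derivative_map, eval_map, ← hom_eval₂, ← aeval_def, hθψ,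
      map_ne_zero_iff _ (algebraMap L (CompletedAlgClosure L)).injective,
      map_ne_zero_iff _ (algebraMap K L).injective]
    exact (Algebra.IsSeparable.isSeparable (PadicBase K ℓ hK) (basePowerBasis hK).gen).aeval_derivative_ne_zero
      (minpoly.aeval _ _)
  have hroot : Φp (rootBdR hK hFK) = ψ (basePowerBasis hK).gen := root_unique hFL f ha ha' hθ hder
  -- conclude by the power basis
  have h : Φp.toRingHom.comp (embBdRHom hK hFK) = ψ := by
    refine ringHom_ext_powerBasis hK (basePowerBasis hK) _ _ (RingHom.ext fun c => ?_) ?_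
    · simp only [RingHom.coe_comp, Function.comp_apply, hψ]
      exact h0 c
    · rw [RingHom.comp_apply, embBdRHom_gen]
      exact hroot
  exact RingHom.congr_fun h x

omit [IsDomain (BDeRhamPlus (integerC K) ℓ)] [IsDomain (BDeRhamPlus (integerC L) ℓ)] in
/-- **`Φp` extends `ι : K̄ → L̄` on Fontaine's sections `F̄ ⊆ B_dR⁺(F)`**:
`Φp (ι_K x) = ι_L (ι x)` for `ι_F = algClosureToBdR` and the chosen `ι = absClosureEmbedding K L`,
provided `e : ℂ_K → ℂ_L` extends `ι` (`CompletedAlgClosureBaseChange`).  Indeed `Φp (ι_K x)` reduces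
to `ι x` under `θ_L` and is a root of `minpoly_L(ι x)`: it is a root of `minpoly_K(x)` pushed along
`K → L ⊆ B_dR⁺(L)` (`ringEquiv_embBdRHom`), which is `minpoly_L(ι x) · R` with `R(ι x) ≠ 0`
(separability), and `R(Φp (ι_K x))` is a unit as its image under `θ` is `R(ι x) ≠ 0`; uniqueness of
Hensel lifts (`eq_liftElt`). [cite: FontaineAsterisque223III, Exp. II §1.5] [cite: BrinonConrad2009, Prop. 6.3.8] -/
theorem ringEquiv_algClosureToBdR (hK : valuation K (ℓ : K) < 1) (hL : valuation L (ℓ : L) < 1)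
    (hFK : Function.Surjective (fontaineTheta (integerC K) ℓ))
    (hFL : Function.Surjective (fontaineTheta (integerC L) ℓ))
    (g : integerC K →+* integerC L) (e : CompletedAlgClosure K →+* CompletedAlgClosure L)
    (hge : ∀ x : integerC K, ((g x : integerC L) : CompletedAlgClosure L) = e x)
    (he : ∀ y : AlgebraicClosure K, e (algClosureToC K y) = algClosureToC L (absClosureEmbedding K L y))
    (Φp : BDeRhamPlus (integerC K) ℓ ≃+* BDeRhamPlus (integerC L) ℓ)
    (hΦp : ∀ x, Φp x = adicCompletionMap _ _ _ (map_ker_fontaineThetaInvertP_le ℓ g) x)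
    (x : AlgebraicClosure K) :
    Φp (algClosureToBdR hK hFK x) = algClosureToBdR hL hFL (absClosureEmbedding K L x) := by
  -- `e` extends `K → L`
  have heK : ∀ y : K, e (algebraMap K (CompletedAlgClosure K) y) =
      algebraMap L (CompletedAlgClosure L) (algebraMap K L y) := by
    intro y
    rw [← algClosureToC_algebraMap, he, AlgHom.commutes, IsScalarTower.algebraMap_apply K L
      (AlgebraicClosure L), algClosureToC_algebraMap]
  set b := Φp (algClosureToBdR hK hFK x) with hb
  have hθ : thetaBdR b = algClosureToC L (absClosureEmbedding K L x) := by
    rw [hb, thetaBdR_ringEquiv_eq hK hL g e hge Φp hΦp, thetaBdR_algClosureToBdR, he]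
  rw [algClosureToBdR_apply hL hFL]
  refine eq_liftElt hL hFL ?_ hθ
  -- `Φp (ι_K x)` is a root of `minpoly_K x` pushed along `K → L ⊆ B_dR⁺(L)`
  have h1 : (letI := bdRPlusAlgebraF hK hFK; aeval (algClosureToBdR hK hFK x) (minpoly K x)) = 0 := by
    rw [algClosureToBdR_apply]; exact aeval_liftElt hK hFK x
  have h2 : (minpoly K x).eval₂ ((embBdRHom hL hFL).comp (algebraMap K L)) b = 0 := by
    letI := bdRPlusAlgebraF hK hFK
    have h := hom_eval₂ (minpoly K x) (algebraMap K (BDeRhamPlus (integerC K) ℓ)) Φp.toRingHom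
      (algClosureToBdR hK hFK x)
    rw [← aeval_def, h1, map_zero] at h
    rw [hb, show Φp (algClosureToBdR hK hFK x) = Φp.toRingHom (algClosureToBdR hK hFK x) from rfl, h]
    congr 1
    refine RingHom.ext fun c => ?_
    simp only [RingHom.coe_comp, Function.comp_apply]
    exact (ringEquiv_embBdRHom hK hL hFK hFL g e hge heK Φp hΦp c).symm
  -- as an `L`-polynomial identity in `B_dR⁺(L)` over `L`
  letI := bdRPlusAlgebraF hL hFL
  have hx0 : aeval (absClosureEmbedding K L x) ((minpoly K x).map (algebraMap K L)) = 0 := by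
    rw [aeval_map_algebraMap, aeval_algHom_apply, minpoly.aeval, map_zero]
  obtain ⟨R, hR⟩ := minpoly.dvd L (absClosureEmbedding K L x) hx0
  have h3 : aeval b ((minpoly K x).map (algebraMap K L)) = 0 := by
    rw [aeval_def, eval₂_map]; exact h2
  rw [hR, map_mul] at h3
  -- `R(ι x) ≠ 0` by separability
  have hsep : ((minpoly K x).map (algebraMap K L)).Separable :=
    Polynomial.Separable.map (show (minpoly K x).Separable from Algebra.IsSeparable.isSeparable K x)
  have hR0 : aeval (absClosureEmbedding K L x) R ≠ 0 := by
    intro h0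
    refine hsep.aeval_derivative_ne_zero hx0 ?_
    rw [hR, derivative_mul, map_add, map_mul, map_mul, h0, minpoly.aeval, mul_zero, zero_mul,
      add_zero]
  -- hence `R(b)` is a unit (its image under `θ` is `R(ι x)`)
  have hθR : thetaBdR (aeval b R) = algClosureToC L (aeval (absClosureEmbedding K L x) R) := by
    calc thetaBdR (aeval b R) = thetaAlgHom hL hFL (aeval b R) := (thetaAlgHom_apply hL hFL _).symm
      _ = aeval (thetaAlgHom hL hFL b) R := (aeval_algHom_apply _ _ _).symm
      _ = aeval (algClosureToCAlgHom L (absClosureEmbedding K L x)) R := by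
          rw [thetaAlgHom_apply, hθ]; rfl
      _ = algClosureToCAlgHom L (aeval (absClosureEmbedding K L x) R) := aeval_algHom_apply _ _ _
      _ = algClosureToC L (aeval (absClosureEmbedding K L x) R) := rfl
  have hunit : IsUnit (aeval b R) := by
    rw [isUnit_iff_thetaBdR_ne_zero hFL, hθR, map_ne_zero_iff _ (algClosureToC L).injective]
    exact hR0
  exact (hunit.mul_left_eq_zero).1 h3

/-! ### Assembly -/

/-- **`B_dR(K) ≃ B_dR(L)` along a continuous embedding `K → L` of `ℓ`-adic fields, with all its
compatibilities.**  There is a ring isomorphism `Φ : B_dR(K) ≃+* B_dR(L)` which is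
(1) equivariant for `res = absGaloisRestrict K L` (`Φ (res τ • b) = τ • Φ b`);
(2) the identity on `ℚ_ℓ ⊆ B_dR⁺`;
(3) an extension of the chosen `ι : K̄ → L̄` along Fontaine's sections `F̄ ⊆ B_dR⁺(F)`
(`Φ (ι_K x) = ι_L (ι x)`); (4) in particular an extension of `K → L ⊆ B_dR(L)` on `K ⊆ B_dR(K)`;
(5) strictly compatible with the filtrations: `b ∈ Fil^i B_dR(K) ↔ Φ b ∈ Fil^i B_dR(L)`.
`Φ = Frac B_dR⁺(g)` for the restriction `g : 𝒪_{ℂ_K} ≃ 𝒪_{ℂ_L}` of the isomorphism `e : ℂ_K ≃ ℂ_L`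
extending `ι` (`exists_completedAlgClosure_ringEquiv`); (1)–(2) as in the accepted
`exists_fracBdR_ringEquiv`, (3)–(5) by the lemmas of this file.  Brinon–Conrad p. 80: "the
construction of `B_dR⁺` … only depends on `𝒪_{ℂ_K}` endowed with its `G_K`-action", and
Prop. 6.3.8 (the comparison is filtered).
[cite: BrinonConrad2009, Prop. 6.3.8] [cite: FontaineAsterisque223III, Exp. II §1.5] -/
theorem exists_fracBdR_ringEquiv_filtered (hcont : Continuous (algebraMap K L))
    (hK : valuation K (ℓ : K) < 1) (hL : valuation L (ℓ : L) < 1)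
    (hFK : Function.Surjective (fontaineTheta (integerC K) ℓ))
    (hFL : Function.Surjective (fontaineTheta (integerC L) ℓ)) :
    ∃ Φ : FracBdR K ℓ ≃+* FracBdR L ℓ,
      (∀ (τ : absoluteGaloisGroup L) (b : FracBdR K ℓ), Φ (absGaloisRestrict K L τ • b) = τ • Φ b) ∧
      (∀ q : ℚ_[ℓ], Φ (algebraMap (BDeRhamPlus (integerC K) ℓ) (FracBdR K ℓ) (qpToBdR q)) =
        algebraMap (BDeRhamPlus (integerC L) ℓ) (FracBdR L ℓ) (qpToBdR q)) ∧
      (∀ x : AlgebraicClosure K,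
        Φ (algebraMap (BDeRhamPlus (integerC K) ℓ) (FracBdR K ℓ) (algClosureToBdR hK hFK x)) =
          algebraMap (BDeRhamPlus (integerC L) ℓ) (FracBdR L ℓ)
            (algClosureToBdR hL hFL (absClosureEmbedding K L x))) ∧
      (∀ x : K, Φ (algebraMap (BDeRhamPlus (integerC K) ℓ) (FracBdR K ℓ) (embBdRHom hK hFK x)) =
        algebraMap (BDeRhamPlus (integerC L) ℓ) (FracBdR L ℓ) (embBdRHom hL hFL (algebraMap K L x))) ∧
      ∀ (i : ℤ) (b : FracBdR K ℓ), (letI := fracAlgebra (p := ℓ) hK hFK; b ∈ fil hK hFK i) ↔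
        letI := fracAlgebra (p := ℓ) hL hFL; Φ b ∈ fil hL hFL i := by
  haveI := algebra_isAlgebraic_of_continuous_algebraMap hcont hK hL
  obtain ⟨c, hc, hcx⟩ := exists_algNorm_absClosureEmbedding_eq_rpow hcont hK hL
  obtain ⟨e, he, he_norm, he_smul⟩ :=
    exists_completedAlgClosure_ringEquiv (absClosureEmbedding_bijective K L) hc hcx
  -- `g : 𝒪_{ℂ_K} ≃ 𝒪_{ℂ_L}`, the restriction of `e` to the unit balls (`c > 0`)
  have hmem : ∀ x : CompletedAlgClosure K, x ∈ integerC K ↔ e x ∈ integerC L := fun x => by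
    rw [mem_integerC_iff, mem_integerC_iff, he_norm]
    simpa only [Real.one_rpow] using
      (Real.rpow_le_rpow_iff (norm_nonneg x) zero_le_one hc).symm
  obtain ⟨g, hg⟩ : ∃ g : integerC K ≃+* integerC L,
      ∀ x : integerC K, ((g x : integerC L) : CompletedAlgClosure L) = e x :=
    ⟨{ (e.toEquiv.subtypeEquiv hmem : integerC K ≃ integerC L) with
        map_mul' := fun x y =>
          Subtype.ext (map_mul e (x : CompletedAlgClosure K) (y : CompletedAlgClosure K))
        map_add' := fun x y =>
          Subtype.ext (map_add e (x : CompletedAlgClosure K) (y : CompletedAlgClosure K)) },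
      fun _ => rfl⟩
  have hgal : ∀ (τ : absoluteGaloisGroup L) (x : integerC K),
      g (galInt (absGaloisRestrict K L τ) x) = galInt τ (g x) := fun τ x =>
    Subtype.ext (by rw [hg, coe_galInt, coe_galInt, hg, he_smul])
  have hge : ∀ x : integerC K, ((g.toRingHom x : integerC L) : CompletedAlgClosure L) = e x := hg
  -- `Φp = B_dR⁺(g)`, an isomorphism with inverse `B_dR⁺(g⁻¹)`
  obtain ⟨Φp, hΦp⟩ : ∃ Φp : BDeRhamPlus (integerC K) ℓ ≃+* BDeRhamPlus (integerC L) ℓ,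
      ∀ x, Φp x = adicCompletionMap _ _ _ (map_ker_fontaineThetaInvertP_le ℓ g.toRingHom) x :=
    ⟨RingEquiv.ofRingHom (adicCompletionMap _ _ _ (map_ker_fontaineThetaInvertP_le ℓ g.toRingHom))
        (adicCompletionMap _ _ _ (map_ker_fontaineThetaInvertP_le ℓ g.symm.toRingHom))
        (bdRPlusMap_comp_eq_id (RingEquiv.toRingHom_comp_symm_toRingHom g))
        (bdRPlusMap_comp_eq_id (RingEquiv.symm_toRingHom_comp_toRingHom g)),
      fun _ => rfl⟩
  have hgalp : ∀ (τ : absoluteGaloisGroup L) (b : BDeRhamPlus (integerC K) ℓ),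
      Φp (galBdRPlus (absGaloisRestrict K L τ) b) = galBdRPlus τ (Φp b) := fun τ b =>
    (hΦp _).trans ((bdRPlusMap_galBdRPlus g.toRingHom (fun τ x => hgal τ x) τ b).trans
      (congrArg (galBdRPlus τ) (hΦp b).symm))
  have hqp : ∀ q : ℚ_[ℓ], Φp (qpToBdR q) = qpToBdR q := fun q =>
    (hΦp _).trans (bdRPlusMap_qpToBdR g.toRingHom q)
  -- `Φ = Frac Φp`
  obtain ⟨Φ, hΦ⟩ : ∃ Φ : FracBdR K ℓ ≃+* FracBdR L ℓ, ∀ x,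
      Φ (algebraMap (BDeRhamPlus (integerC K) ℓ) (FracBdR K ℓ) x) =
        algebraMap (BDeRhamPlus (integerC L) ℓ) (FracBdR L ℓ) (Φp x) :=
    ⟨IsFractionRing.ringEquivOfRingEquiv Φp, IsFractionRing.ringEquivOfRingEquiv_algebraMap Φp⟩
  refine ⟨Φ, fun τ b => ?_, fun q => (hΦ _).trans (congrArg (algebraMap _ (FracBdR L ℓ)) (hqp q)),
    fun x => ?_, fun x => ?_, fun i b => mem_fil_iff_ringEquiv_mem_fil hK hL hFK hFL Φp Φ hΦ i b⟩
  · have h : Φ.toRingHom.comp (MulSemiringAction.toRingHom (absoluteGaloisGroup K) (FracBdR K ℓ)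
          (absGaloisRestrict K L τ)) =
        (MulSemiringAction.toRingHom (absoluteGaloisGroup L) (FracBdR L ℓ) τ).comp Φ.toRingHom :=
      IsLocalization.ringHom_ext (nonZeroDivisors (BDeRhamPlus (integerC K) ℓ)) (RingHom.ext fun x =>
        show Φ (absGaloisRestrict K L τ • algebraMap _ (FracBdR K ℓ) x) =
            τ • Φ (algebraMap _ (FracBdR K ℓ) x) from
          (congrArg Φ (smul_algebraMap_fracBdR _ x)).trans <| (hΦ _).trans <|
            (congrArg (algebraMap _ (FracBdR L ℓ)) (hgalp τ x)).trans <|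
              (smul_algebraMap_fracBdR τ (Φp x)).symm.trans (congrArg (τ • ·) (hΦ x).symm))
    exact RingHom.congr_fun h b
  · rw [hΦ, ringEquiv_algClosureToBdR hK hL hFK hFL g.toRingHom e.toRingHom hge he Φp hΦp x]
  · have heK : ∀ y : K, e (algebraMap K (CompletedAlgClosure K) y) =
        algebraMap L (CompletedAlgClosure L) (algebraMap K L y) := by
      intro y
      rw [← algClosureToC_algebraMap, he, AlgHom.commutes, IsScalarTower.algebraMap_apply K L
        (AlgebraicClosure L), algClosureToC_algebraMap]
    rw [hΦ, ringEquiv_embBdRHom hK hL hFK hFL g.toRingHom e.toRingHom hge heK Φp hΦp x]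

end LocalField

end Literature.NumberTheory.PAdicHodge

end
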